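import Summits.HodgeConjecture.HodgeConjecture.Theorems.F0P2cSocketCOfStubs
import Summits.HodgeConjecture.HodgeConjecture.Theorems.F0P2cStubCI
import Summits.HodgeConjecture.HodgeConjecture.Theorems.P2StubCFFlathRigidity
import Summits.HodgeConjecture.HodgeConjecture.Theorems.F0P2eCEOfRung2
import Summits.HodgeConjecture.HodgeConjecture.Theorems.F0P2fE3OfRung2
import Summits.HodgeConjecture.HodgeConjecture.Theorems.F0P2eStubGLGlobalLine
import Summits.HodgeConjecture.HodgeConjecture.Theorems.F0P2eStubLWLocalWitness
import Summits.HodgeConjecture.HodgeConjecture.Theorems.F0P2eStubLRLocalReindex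
import Summits.HodgeConjecture.HodgeConjecture.Theorems.F0P2eStubLTLocalTypeTransport
import HarnessLib

/-!
# Crux `H413`, (C) desk — THE SUCCESSOR: the (C♭) socket and the crux FROM THE ENGINE LETTER CE ALONE, every in-house stub of the (C)-line
# DISCHARGED BY NAME (CL ★ p799835 p03 · CI ★ `F0P2cStubCI.stubCI_holds` p02 · CF ★ `P2StubCFFlathRigidity.stubCF_holds` A-p08 (+ p04, A-p02) · (D) ★ p799091)

Cell hodgecm-mathlib (D-0151), FLOOR 0, crux item H413 = stmt-HodgeConjecture-24833; programme P2; (C)-desk sub-line `Cruxes/H413/Lines/F0_P2CohFinComponentIsThetaC.lean`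
(v1.1 of record, F0P2-plan (g3); registrar A-plan1 (g18)).  Author F0P2-p01 (g3).  THEOREMS ONLY (no `def`, no instance, no named fact, no `sorry`);
`--supports stmt-HodgeConjecture-24833 --as helper`; no Lines import (s380b).  HC_CM is proved only modulo the printed citations until rung 0 closes; this file
proves nothing about them — it is the ONE kernel term exhibiting the (C♭) socket as a function of the engine letter CE alone, and the crux as a function of EXACTLY
the two engine letters CE, U4 and the two floor rows.

Over the Theorems-level assembly ★ `F0P2cSocketCOfStubs.cohFinComponentIsThetaAdm_of_CE_CF_CI (hCE) (hCF) (hCI)` ∕ `H413_of_CE_CF_CI_U4` (p800266: CL ★ and (D) ★ consumed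
by name) the two in-house hypotheses are discharged BY NAME with ZERO glue — their closers have the registered bodies (with `IsLocalTypeAt` unfolded) as types,
binder for binder: `hCF :=` ★ `P2StubCFFlathRigidity.stubCF_holds` (A-p08 (g16), p801844: Flath rigidity for `U(J)(𝔸_{F,f})` over ★ `P2StubCFOfLocal.stubCF_of_local`,
★ `RestrictedProductFixedVectorLift`, ★ `IsotypicHeckeScalar`, ★ `RestrictedProductBoxHeckeScalar`, ★ `IsotypicFamilyPeel` ∕ `IsotypicFamilyRigidity` ∕
`FiniteFamilyIsotypicRigidity` (A-p02 (g18)), ★ `UnitaryGroupLocalTypeSpherical` (F0P2-p04 (g2))) and `hCI :=` ★ `F0P2cStubCI.stubCI_holds` (F0P2-p02 (g2):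
`ω_H` irreducible ∧ admissible at general frame data from the inputs of ★ `H411_proof`).

* `cohFinComponentIsThetaAdm_of_CE (hCE) : ‹(C♭)›` — the (C♭) socket IS the engine letter CE (modulo in-house ★ theorems);
* **`H413_of_CE_U4 (hCE) (hU4) (hJ3a) (hocc) : HCCMUnconditional.H413`** — THE FLOOR-0 P2 CENSUS OF RECORD AT THEOREMS LEVEL: {CE (Rogawski's classification
  of the cohomological spectrum of `U(2,1)`, read per place), U4 (the sign rule ⇐ E3 parity)} ∪ rows {J3a (P3), occ (P4)}; (C′), (D), (D̄), CL, CF, CI, CA, CU gone.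
  (With ★ `F0P2cStubCEOfLocalThetaTypes.stubCE_of_localThetaTypes` the letter CE may further be replaced by its automorphic core CE_R.)

## References
* [Rogawski1990] Thm 13.3.1, Thm 13.3.6 (c), §12.3, §13.3, §14.6.  [Rogawski1992] Thm 1.1.  [GelbartRogawski1991] Thm 5.1.1, Lem 5.1.2.  [HarrisKudlaSweet1996] Thm 6.1.
* [Liu2021] Def 4.11, Prop 4.13 and proof l. 2121–2146, Rem 4.14, App. D Lem D.1 (1)(3).  [Flath1979] Thm 2, Thm 3.  [Bump1997] §3.4.  [BorelJacquet1979] §4.3, §4.6.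
* [MoeglinVignerasWaldspurger1987] Chap. 3 IV.  [GetzHahn2024] Thm 5.5.1, Thm 5.7.1.
-/

set_option autoImplicit false

-- the mandated namespace has the single-problem summit's repeated segment (`HodgeConjecture.HodgeConjecture`)
set_option linter.dupNamespace false

noncomputable section

namespace Summit.HodgeConjecture.HodgeConjecture.Cruxes.H413.F0P2cSocketC

open NumberField MeasureTheory IsDedekindDomain
open scoped Matrix ComplexOrder
open Literature.NumberTheory.Automorphic Literature.NumberTheory.Automorphic.UnitaryGroup
open Literature.NumberTheory.Automorphic.UnitaryGroup.CotangentForms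
open Literature.NumberTheory.Automorphic.IdeleClassGroup
open Literature.NumberTheory.Automorphic.Liu2021 Literature.NumberTheory.Automorphic.Liu2021.Def411WeilCarriers
open Literature.NumberTheory.Automorphic.Liu2021.Def411WeilCarriersDoubling
open Literature.NumberTheory.GelbartRogawski1991 Literature.NumberTheory.GelbartRogawski1991.UnitaryDualPair
open Literature.RepresentationTheory.Liu2021
open Literature.NumberTheory.Rogawski1990
open Summit.HodgeConjecture.HodgeConjecture.Cruxes.H413.SpectrumInterfaces (StubU4SignRule HJ3aType HoccType)

set_option synthInstance.maxHeartbeats 400000 in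
set_option maxHeartbeats 8000000 in
/-- **THE (C♭) SOCKET FROM THE ENGINE LETTER CE ALONE** — CL ★ (p03, p799835), CF ★ (A-p08, `P2StubCFFlathRigidity.stubCF_holds`), CI ★ (p02,
`F0P2cStubCI.stubCI_holds`) consumed BY NAME over ★ `F0P2cSocketCOfStubs.cohFinComponentIsThetaAdm_of_CE_CF_CI`.  The hypothesis is the registered body of
`StubCELocalTypesTheta` (tree v1.1 :210) with `IsLocalTypeAt` unfolded. [cite: Flath1979, Thm 3] [cite: Rogawski1990, Thm 13.3.6 (c)]
[cite: Liu2021, Def 4.11, Rem 4.14, App. D Lem D.1] -/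
theorem cohFinComponentIsThetaAdm_of_CE
    (hCE :
      ∀ (L : Type) [Field L] [NumberField L] [IsCMField L] (ι : L →+* ℂ) (H : Matrix (Fin 3) (Fin 3) L) (T : GL (Fin 3) ℂ)
        (hT : (T : Matrix (Fin 3) (Fin 3) ℂ)ᴴ * H.map ι * (T : Matrix (Fin 3) (Fin 3) ℂ) = Literature.Geometry.ComplexHyperbolic.BallModel.J),
        (∀ τ' : L →+* ℂ, InfinitePlace.mk τ' ≠ InfinitePlace.mk ι → (H.map τ').PosDef) → 2 ≤ Module.finrank ℚ ↥(maximalRealSubfield L) →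
        ∀ {n' : ℕ} (e₁ : Fin 3 × Fin 1 ≃ Fin n') (dV : Fin 3 → L) (hdV : ∀ i, IsCMField.complexConj L (dV i) = dV i)
          (hdV0 : ∀ i, dV i ≠ 0) (g : GL (Fin 3) L),
          ((g : Matrix (Fin 3) (Fin 3) L).map (cmConjRingHom L))ᵀ * H * (g : Matrix (Fin 3) (Fin 3) L) = Matrix.diagonal dV →
          ∀ (ιV : finAdelic (↥(maximalRealSubfield L)) L (IsCMField.complexConj L) 3 H →*
              finAdelic (↥(maximalRealSubfield L)) L (IsCMField.complexConj L) 3 (Matrix.diagonal dV)),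
            (∀ k, ((ιV k : finAdelic (↥(maximalRealSubfield L)) L (IsCMField.complexConj L) 3 (Matrix.diagonal dV)) :
                GL (Fin 3) (FiniteAdeleRing (𝓞 L) L)) =
              (toFinAdeleGL L 3 g)⁻¹ * (k : GL (Fin 3) (FiniteAdeleRing (𝓞 L) L)) * toFinAdeleGL L 3 g) →
            ∀ (μ : Measure (adelicGroupData (↥(maximalRealSubfield L)) L (IsCMField.complexConj L) 3 H).automorphicQuotient)
              [(adelicGroupData (↥(maximalRealSubfield L)) L (IsCMField.complexConj L) 3 H).IsAutomorphicMeasure μ]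
              (W : Type) [AddCommGroup W] [Module ℂ W]
              (σ : Representation ℂ (finAdelic (↥(maximalRealSubfield L)) L (IsCMField.complexConj L) 3 H) W),
              σ.IsIrreducible → σ.IsSmooth → σ.IsAdmissible →
              ∀ P : DiscreteAutomorphicRep (adelicGroupData (↥(maximalRealSubfield L)) L (IsCMField.complexConj L) 3 H) μ,
                (P.IsHolCotangentAt (cmArchSection L ι H T hT) (cmCompactFactor L ι H T hT) ∨
                  P.IsAntiholCotangentAt (cmArchSection L ι H T hT) (cmCompactFactor L ι H T hT)) →
                P.HasFinComponent σ →
                ∃ (μ : Literature.NumberTheory.Automorphic.IdeleClassGroup L →ₜ* Circle) (hμ : IsConjugateSymplectic L μ), HasWeight L μ 1 ∧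
                  ∃ (a : (↥(maximalRealSubfield L))ˣ) (χ : Chi (↥(maximalRealSubfield L)) L (IsCMField.complexConj L)),
                    ∀ (v : HeightOneSpectrum (𝓞 ↥(maximalRealSubfield L))) (Tv : Type) [AddCommGroup Tv] [Module ℂ Tv]
                      (τ : Representation ℂ (localPi L (IsCMField.complexConj L) 3 H v) Tv),
                      (τ.IsIrreducible ∧
                        isotypicComponent (MonoidAlgebra ℂ (localPi L (IsCMField.complexConj L) 3 H v))
                          (Representation.asModule (σ.comp (inclPlace (↥(maximalRealSubfield L)) L (IsCMField.complexConj L) 3 H v)))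
                          (Representation.asModule τ) = ⊤) →
                      (τ.IsIrreducible ∧
                        isotypicComponent (MonoidAlgebra ℂ (localPi L (IsCMField.complexConj L) 3 H v))
                          (Representation.asModule
                            ((rhoAtLine (↥(maximalRealSubfield L)) L (IsCMField.complexConj L) 3 e₁ (Matrix.diagonal dV)
                        (complexConj_imagUnit L) (imagUnit_ne_zero L) (imagUnit_mul_self L) (realDiagonal_isSymm L dV hdV)
                        (isUnit_det_realDiagonal L dV hdV hdV0) (realDiagonal_map L dV hdV).symm
                        (fun a => isCompatible_chiSplittingLine L e₁ dV hdV hdV0 (toHeckeCharacter L μ)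
                          (isUnitary_toHeckeCharacter L μ) ((isOscillatorChar_toHeckeCharacter_iff μ).mpr hμ)
                          (TW (↥(maximalRealSubfield L)) a) (isSymm_TW (↥(maximalRealSubfield L)) a)
                          (isUnit_det_TW (↥(maximalRealSubfield L)) a) (JW (↥(maximalRealSubfield L)) L a)
                          (JW_eq (↥(maximalRealSubfield L)) L a)) ιV a χ).comp
                              (inclPlace (↥(maximalRealSubfield L)) L (IsCMField.complexConj L) 3 H v)))
                          (Representation.asModule τ) = ⊤)) :
      ∀ (L : Type) [Field L] [NumberField L] [IsCMField L] (ι : L →+* ℂ) (H : Matrix (Fin 3) (Fin 3) L) (T : GL (Fin 3) ℂ)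
        (hT : (T : Matrix (Fin 3) (Fin 3) ℂ)ᴴ * H.map ι * (T : Matrix (Fin 3) (Fin 3) ℂ) = Literature.Geometry.ComplexHyperbolic.BallModel.J),
        (∀ τ' : L →+* ℂ, InfinitePlace.mk τ' ≠ InfinitePlace.mk ι → (H.map τ').PosDef) →
        2 ≤ Module.finrank ℚ ↥(maximalRealSubfield L) →
        -- the ω-side frame data (lane convention: diagonal Gram matrix over `L⁺`) and the frame transport, pinned extensionally
        ∀ {n' : ℕ} (e₁ : Fin 3 × Fin 1 ≃ Fin n') (dV : Fin 3 → L) (hdV : ∀ i, IsCMField.complexConj L (dV i) = dV i)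
          (hdV0 : ∀ i, dV i ≠ 0) (g : GL (Fin 3) L),
          ((g : Matrix (Fin 3) (Fin 3) L).map (cmConjRingHom L))ᵀ * H * (g : Matrix (Fin 3) (Fin 3) L) = Matrix.diagonal dV →
        ∀ (ιV : finAdelic (↥(maximalRealSubfield L)) L (IsCMField.complexConj L) 3 H →*
            finAdelic (↥(maximalRealSubfield L)) L (IsCMField.complexConj L) 3 (Matrix.diagonal dV)),
          (∀ k : finAdelic (↥(maximalRealSubfield L)) L (IsCMField.complexConj L) 3 H,
            ((ιV k : finAdelic (↥(maximalRealSubfield L)) L (IsCMField.complexConj L) 3 (Matrix.diagonal dV)) :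
                GL (Fin 3) (FiniteAdeleRing (𝓞 L) L)) =
              (toFinAdeleGL L 3 g)⁻¹ * (k : GL (Fin 3) (FiniteAdeleRing (𝓞 L) L)) * toFinAdeleGL L 3 g) →
        ∀ (μ : Measure (adelicGroupData (↥(maximalRealSubfield L)) L (IsCMField.complexConj L) 3 H).automorphicQuotient)
          [(adelicGroupData (↥(maximalRealSubfield L)) L (IsCMField.complexConj L) 3 H).IsAutomorphicMeasure μ]
          (W : Type) [AddCommGroup W] [Module ℂ W]
          (σ : Representation ℂ (finAdelic (↥(maximalRealSubfield L)) L (IsCMField.complexConj L) 3 H) W),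
          σ.IsIrreducible → σ.IsSmooth → σ.IsAdmissible →
        ∀ P : DiscreteAutomorphicRep (adelicGroupData (↥(maximalRealSubfield L)) L (IsCMField.complexConj L) 3 H) μ,
          (P.IsHolCotangentAt (cmArchSection L ι H T hT) (cmCompactFactor L ι H T hT) ∨
              P.IsAntiholCotangentAt (cmArchSection L ι H T hT) (cmCompactFactor L ι H T hT)) →
          P.HasFinComponent σ →
            ∃ (μ : Literature.NumberTheory.Automorphic.IdeleClassGroup L →ₜ* Circle)
              (hμ : Literature.NumberTheory.Automorphic.IdeleClassGroup.IsConjugateSymplectic L μ),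
              Literature.NumberTheory.Automorphic.IdeleClassGroup.HasWeight L μ 1 ∧
              ∃ (a : (↥(maximalRealSubfield L))ˣ) (χ : Chi (↥(maximalRealSubfield L)) L (IsCMField.complexConj L)),
                ∃ f : σ.IntertwiningMap
                    (rhoAtLine (↥(maximalRealSubfield L)) L (IsCMField.complexConj L) 3 e₁ (Matrix.diagonal dV)
                      (complexConj_imagUnit L) (imagUnit_ne_zero L) (imagUnit_mul_self L) (realDiagonal_isSymm L dV hdV)
                      (isUnit_det_realDiagonal L dV hdV hdV0) (realDiagonal_map L dV hdV).symm
                      (fun a => isCompatible_chiSplittingLine L e₁ dV hdV hdV0 (toHeckeCharacter L μ)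
                        (isUnitary_toHeckeCharacter L μ) ((isOscillatorChar_toHeckeCharacter_iff μ).mpr hμ)
                        (TW (↥(maximalRealSubfield L)) a) (isSymm_TW (↥(maximalRealSubfield L)) a)
                        (isUnit_det_TW (↥(maximalRealSubfield L)) a) (JW (↥(maximalRealSubfield L)) L a)
                        (JW_eq (↥(maximalRealSubfield L)) L a))
                      ιV a χ),
                  Function.Injective f :=
  F0P2cSocketCOfStubs.cohFinComponentIsThetaAdm_of_CE_CF_CI hCE P2StubCFFlathRigidity.stubCF_holds F0P2cStubCI.stubCI_holds

set_option synthInstance.maxHeartbeats 400000 in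
set_option maxHeartbeats 8000000 in
/-- **THE CRUX `HCCMUnconditional.H413` BY NAME FROM THE TWO ENGINE LETTERS CE (`StubCELocalTypesTheta`, Rogawski's endoscopic classification read per place),
U4 (`StubU4SignRule` ⇐ E3 parity) AND THE FLOOR ROWS `hJ3a` (P3), `hocc` (P4)** — every in-house stub of programme P2 on floor 0 DISCHARGED BY NAME: (D) ★ p799091,
(D̄) ★ p794879, (C′) ★ p796532, CL ★ p799835, CF ★ `P2StubCFFlathRigidity.stubCF_holds`, CI ★ `F0P2cStubCI.stubCI_holds`; admissibility (CA) at the pin by ★ S3.  THE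
FLOOR-0 P2 CENSUS OF RECORD: {CE, U4} ∪ rows {J3a, occ}.  HC_CM is proved only modulo the printed citations until rung 0 closes.
[cite: Liu2021, Prop. 4.13 and proof l. 2121–2146; Rem. 4.14] [cite: GelbartRogawski1991, Thm 5.1.1; Lem 5.1.2] [cite: Rogawski1990, Thm. 13.3.1, Thm. 13.3.6 (c)]
[cite: Rogawski1992, Thm 1.1] [cite: Flath1979, Thm 3] -/
theorem H413_of_CE_U4
    (hCE :
      ∀ (L : Type) [Field L] [NumberField L] [IsCMField L] (ι : L →+* ℂ) (H : Matrix (Fin 3) (Fin 3) L) (T : GL (Fin 3) ℂ)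
        (hT : (T : Matrix (Fin 3) (Fin 3) ℂ)ᴴ * H.map ι * (T : Matrix (Fin 3) (Fin 3) ℂ) = Literature.Geometry.ComplexHyperbolic.BallModel.J),
        (∀ τ' : L →+* ℂ, InfinitePlace.mk τ' ≠ InfinitePlace.mk ι → (H.map τ').PosDef) → 2 ≤ Module.finrank ℚ ↥(maximalRealSubfield L) →
        ∀ {n' : ℕ} (e₁ : Fin 3 × Fin 1 ≃ Fin n') (dV : Fin 3 → L) (hdV : ∀ i, IsCMField.complexConj L (dV i) = dV i)
          (hdV0 : ∀ i, dV i ≠ 0) (g : GL (Fin 3) L),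
          ((g : Matrix (Fin 3) (Fin 3) L).map (cmConjRingHom L))ᵀ * H * (g : Matrix (Fin 3) (Fin 3) L) = Matrix.diagonal dV →
          ∀ (ιV : finAdelic (↥(maximalRealSubfield L)) L (IsCMField.complexConj L) 3 H →*
              finAdelic (↥(maximalRealSubfield L)) L (IsCMField.complexConj L) 3 (Matrix.diagonal dV)),
            (∀ k, ((ιV k : finAdelic (↥(maximalRealSubfield L)) L (IsCMField.complexConj L) 3 (Matrix.diagonal dV)) :
                GL (Fin 3) (FiniteAdeleRing (𝓞 L) L)) =
              (toFinAdeleGL L 3 g)⁻¹ * (k : GL (Fin 3) (FiniteAdeleRing (𝓞 L) L)) * toFinAdeleGL L 3 g) →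
            ∀ (μ : Measure (adelicGroupData (↥(maximalRealSubfield L)) L (IsCMField.complexConj L) 3 H).automorphicQuotient)
              [(adelicGroupData (↥(maximalRealSubfield L)) L (IsCMField.complexConj L) 3 H).IsAutomorphicMeasure μ]
              (W : Type) [AddCommGroup W] [Module ℂ W]
              (σ : Representation ℂ (finAdelic (↥(maximalRealSubfield L)) L (IsCMField.complexConj L) 3 H) W),
              σ.IsIrreducible → σ.IsSmooth → σ.IsAdmissible →
              ∀ P : DiscreteAutomorphicRep (adelicGroupData (↥(maximalRealSubfield L)) L (IsCMField.complexConj L) 3 H) μ,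
                (P.IsHolCotangentAt (cmArchSection L ι H T hT) (cmCompactFactor L ι H T hT) ∨
                  P.IsAntiholCotangentAt (cmArchSection L ι H T hT) (cmCompactFactor L ι H T hT)) →
                P.HasFinComponent σ →
                ∃ (μ : Literature.NumberTheory.Automorphic.IdeleClassGroup L →ₜ* Circle) (hμ : IsConjugateSymplectic L μ), HasWeight L μ 1 ∧
                  ∃ (a : (↥(maximalRealSubfield L))ˣ) (χ : Chi (↥(maximalRealSubfield L)) L (IsCMField.complexConj L)),
                    ∀ (v : HeightOneSpectrum (𝓞 ↥(maximalRealSubfield L))) (Tv : Type) [AddCommGroup Tv] [Module ℂ Tv]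
                      (τ : Representation ℂ (localPi L (IsCMField.complexConj L) 3 H v) Tv),
                      (τ.IsIrreducible ∧
                        isotypicComponent (MonoidAlgebra ℂ (localPi L (IsCMField.complexConj L) 3 H v))
                          (Representation.asModule (σ.comp (inclPlace (↥(maximalRealSubfield L)) L (IsCMField.complexConj L) 3 H v)))
                          (Representation.asModule τ) = ⊤) →
                      (τ.IsIrreducible ∧
                        isotypicComponent (MonoidAlgebra ℂ (localPi L (IsCMField.complexConj L) 3 H v))
                          (Representation.asModule
                            ((rhoAtLine (↥(maximalRealSubfield L)) L (IsCMField.complexConj L) 3 e₁ (Matrix.diagonal dV)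
                        (complexConj_imagUnit L) (imagUnit_ne_zero L) (imagUnit_mul_self L) (realDiagonal_isSymm L dV hdV)
                        (isUnit_det_realDiagonal L dV hdV hdV0) (realDiagonal_map L dV hdV).symm
                        (fun a => isCompatible_chiSplittingLine L e₁ dV hdV hdV0 (toHeckeCharacter L μ)
                          (isUnitary_toHeckeCharacter L μ) ((isOscillatorChar_toHeckeCharacter_iff μ).mpr hμ)
                          (TW (↥(maximalRealSubfield L)) a) (isSymm_TW (↥(maximalRealSubfield L)) a)
                          (isUnit_det_TW (↥(maximalRealSubfield L)) a) (JW (↥(maximalRealSubfield L)) L a)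
                          (JW_eq (↥(maximalRealSubfield L)) L a)) ιV a χ).comp
                              (inclPlace (↥(maximalRealSubfield L)) L (IsCMField.complexConj L) 3 H v)))
                          (Representation.asModule τ) = ⊤))
    (hU4 : StubU4SignRule) (hJ3a : HJ3aType) (hocc : HoccType) :
    Summit.HodgeConjecture.HodgeConjecture.Theses.HCCMUnconditional.H413 :=
  F0P2cSocketCOfStubs.H413_of_CE_CF_CI_U4 hCE P2StubCFFlathRigidity.stubCF_holds F0P2cStubCI.stubCI_holds hU4 hJ3a hocc


/-! ## v2 — THE RUNG-2 END STATE: the crux from the two ENGINE letters PK (CE road) and E3♭ (E3 road) — CE ⟸ PK over ★ `F0P2eCEOfRung2` (p809975; GL ★ p808695,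
LW ★ p808696 F0P2-p03 (g3) · LR ★ p808692 F0P2-p04 (g3) · LTpu ★ p808809 F0P2-p02 (g2)) and U4 ⟸ E3 ⟸ E3♭ over ★ `F0P2fE3OfRung2` (p810559 F0P2-p04 (g3); EB ★ p810145,
EP + E3fin ★ p810280).  Hypothesis texts = TREE `Lines/F0_P2CELocalToGlobal.lean` v1.1 `StubPKLocalThetaClasses` :217 and TREE `Lines/F0_P2E3ParityRecut.lean` v1.1
`StubE3FlatAutomorphicParity` §1 VERBATIM (F0P2-plan (g4) rulings 03:44:37Z ∕ 03:57:21Z; census certificate `F0/P2/CERT-P2-census.bypaste.F0P2p01g3.lean`). -/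

-- opens for the rung-2 letter texts PK (CE sub-line :217) and E3♭ (E3 sub-line §1), as in those files
open scoped TensorProduct
open NumberField.InfinitePlace
open Literature.NumberTheory
open Literature.NumberTheory.GelbartRogawski1991.UnitaryDualPair.WeilCoinv
open Literature.RepresentationTheory
open Literature.NumberTheory.Automorphic.Liu2021.AppendixC
open Summit.HodgeConjecture.CorCM
open Summit.HodgeConjecture.CorCM.Transposition
open HodgeCM.Model HodgeCM.Model.LiuIndex HodgeCM.Model.TowerCarrier
open Summit.HodgeConjecture.CorCM.Model

set_option synthInstance.maxHeartbeats 400000 in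
set_option maxHeartbeats 16000000 in
/-- **THE CRUX `HCCMUnconditional.H413` BY NAME FROM EXACTLY THE TWO RUNG-2 ENGINE LETTERS PK (`StubPKLocalThetaClasses`: at every finite place the local
component of a cotangent-type finite component is Liu's local theta type for local classes `ε_v`, cofinitely one class — Rogawski §13.3 + the GR91∕HKS96 packet
dictionary, NO Hasse, NO `rhoAtLine`) and E3♭ (`StubE3FlatAutomorphicParity`: automorphic parity — Rogawski 1992 Thm 1.1) AND THE FLOOR ROWS `hJ3a` (P3), `hocc` (P4)**:
every in-house stub of programme P2 (CL, CF, CI, GL, LW, LR, LTpu, CER, EB, EP, E3fin, (D), (D̄), (C′), U1′, U2′) is DISCHARGED BY NAME inside ★ files.  THE FLOOR-0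
P2 CENSUS OF RECORD AT THEOREMS LEVEL: {PK, E3♭} ∪ rows {J3a, occ}.  HC_CM is proved only modulo the printed citations until rung 0 closes.
[cite: Rogawski1990, Thm 13.3.6 (c), Thm 13.1.1, §13.3] [cite: Rogawski1992, Thm 1.1] [cite: GelbartRogawski1991, Thm 5.1.1, Lem 5.1.2] [cite: HarrisKudlaSweet1996, Thm 6.1]
[cite: Liu2021, Prop. 4.13 and proof l. 2121–2146; Rem. 4.14; Def 4.11–4.12; App. D Lem D.1 (1)(3)] -/
theorem H413_of_PK_E3flat
    (hPK :
      ∀ (L : Type) [Field L] [NumberField L] [IsCMField L] (ι : L →+* ℂ) (H : Matrix (Fin 3) (Fin 3) L) (T : GL (Fin 3) ℂ)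
        (hT : (T : Matrix (Fin 3) (Fin 3) ℂ)ᴴ * H.map ι * (T : Matrix (Fin 3) (Fin 3) ℂ) = Literature.Geometry.ComplexHyperbolic.BallModel.J),
        (∀ τ' : L →+* ℂ, InfinitePlace.mk τ' ≠ InfinitePlace.mk ι → (H.map τ').PosDef) → 2 ≤ Module.finrank ℚ ↥(maximalRealSubfield L) →
        ∀ {n' : ℕ} (e₁ : Fin 3 × Fin 1 ≃ Fin n') (dV : Fin 3 → L) (hdV : ∀ i, IsCMField.complexConj L (dV i) = dV i)
          (hdV0 : ∀ i, dV i ≠ 0) (g : GL (Fin 3) L)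
          (hg : ((g : Matrix (Fin 3) (Fin 3) L).map (cmConjRingHom L))ᵀ * H * (g : Matrix (Fin 3) (Fin 3) L) = Matrix.diagonal dV)
          (ιV : finAdelic (↥(maximalRealSubfield L)) L (IsCMField.complexConj L) 3 H →*
              finAdelic (↥(maximalRealSubfield L)) L (IsCMField.complexConj L) 3 (Matrix.diagonal dV)),
            (∀ k, ((ιV k : finAdelic (↥(maximalRealSubfield L)) L (IsCMField.complexConj L) 3 (Matrix.diagonal dV)) :
                GL (Fin 3) (FiniteAdeleRing (𝓞 L) L)) =
              (toFinAdeleGL L 3 g)⁻¹ * (k : GL (Fin 3) (FiniteAdeleRing (𝓞 L) L)) * toFinAdeleGL L 3 g) →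
            ∀ (μ : Measure (adelicGroupData (↥(maximalRealSubfield L)) L (IsCMField.complexConj L) 3 H).automorphicQuotient)
              [(adelicGroupData (↥(maximalRealSubfield L)) L (IsCMField.complexConj L) 3 H).IsAutomorphicMeasure μ]
              (W : Type) [AddCommGroup W] [Module ℂ W]
              (σ : Representation ℂ (finAdelic (↥(maximalRealSubfield L)) L (IsCMField.complexConj L) 3 H) W),
              σ.IsIrreducible → σ.IsSmooth → σ.IsAdmissible →
              ∀ P : DiscreteAutomorphicRep (adelicGroupData (↥(maximalRealSubfield L)) L (IsCMField.complexConj L) 3 H) μ,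
                (P.IsHolCotangentAt (cmArchSection L ι H T hT) (cmCompactFactor L ι H T hT) ∨
                  P.IsAntiholCotangentAt (cmArchSection L ι H T hT) (cmCompactFactor L ι H T hT)) →
                P.HasFinComponent σ →
                ∃ (μ : Literature.NumberTheory.Automorphic.IdeleClassGroup L →ₜ* Circle) (hμ : IsConjugateSymplectic L μ), HasWeight L μ 1 ∧
                  ∃ (χ : Chi (↥(maximalRealSubfield L)) L (IsCMField.complexConj L))
                    (ε : HeightOneSpectrum (𝓞 ↥(maximalRealSubfield L)) → (↥(maximalRealSubfield L))ˣ) (a₀ : (↥(maximalRealSubfield L))ˣ),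
                    (∀ᶠ v in Filter.cofinite, locF (↥(maximalRealSubfield L)) (imagUnitSq L) (ε v) v = locF (↥(maximalRealSubfield L)) (imagUnitSq L) a₀ v) ∧
                      ∀ (v : HeightOneSpectrum (𝓞 ↥(maximalRealSubfield L))),
                        isotypicComponent (MonoidAlgebra ℂ (localPi L (IsCMField.complexConj L) 3 H v))
                          (Representation.asModule (σ.comp (inclPlace (↥(maximalRealSubfield L)) L (IsCMField.complexConj L) 3 H v)))
                          (Representation.asModule
                            (((show Representation ℂ (localPi L (IsCMField.complexConj L) 3 (Matrix.diagonal dV) v) _ from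
                              (TwistedCoinv.rep (localCharOfCenter (↥(maximalRealSubfield L)) L (IsCMField.complexConj L)
                                  (JW (↥(maximalRealSubfield L)) L (ε v)) (JW_apply_ne_zero (↥(maximalRealSubfield L)) L (ε v)) χ.1 v)
                                ((OmegaChiSplitting.chiLocalSplittingsD ⟨L⟩ e₁ dV hdV hdV0 (toHeckeCharacter L μ)
                                  ((isOscillatorChar_toHeckeCharacter_iff μ).mpr hμ) (ε v)).omegaLoc v)
                                (commute_omegaLoc_localCenter (↥(maximalRealSubfield L)) L (IsCMField.complexConj L) 3 e₁ (Matrix.diagonal dV)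
                                  (JW (↥(maximalRealSubfield L)) L (ε v)) (complexConj_imagUnit L) (imagUnit_ne_zero L) (imagUnit_mul_self L)
                                  (realDiagonal_isSymm L dV hdV) (isSymm_TW (↥(maximalRealSubfield L)) (ε v)) (realDiagonal_map L dV hdV).symm
                                  (JW_eq (↥(maximalRealSubfield L)) L (ε v)) (JW_apply_ne_zero (↥(maximalRealSubfield L)) L (ε v))
                                  (OmegaChiSplitting.chiLocalSplittingsD ⟨L⟩ e₁ dV hdV hdV0 (toHeckeCharacter L μ)
                                    ((isOscillatorChar_toHeckeCharacter_iff μ).mpr hμ) (ε v)) v)).comp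
                                (UnitaryGroup.localLineInl L (IsCMField.complexConj L) 3 e₁ (Matrix.diagonal dV) (JW (↥(maximalRealSubfield L)) L (ε v)) v)) :
                                localPi L (IsCMField.complexConj L) 3 (Matrix.diagonal dV) v →* _).comp
                              (localCongr L (IsCMField.complexConj L) g one_ne_zero
                                (F0P2cOmegaLocalType.formCongr_frame L H dV g hg) v).symm.toMulEquiv.toMonoidHom)) = ⊤
    )
    (hE :
      ∀ (L : Type) [Field L] [NumberField L] [IsCMField L] (ι : L →+* ℂ) (H : Matrix (Fin 3) (Fin 3) L) (T : GL (Fin 3) ℂ)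
        (hT : (T : Matrix (Fin 3) (Fin 3) ℂ)ᴴ * H.map ι * (T : Matrix (Fin 3) (Fin 3) ℂ) = Literature.Geometry.ComplexHyperbolic.BallModel.J),
        (∀ τ' : L →+* ℂ, InfinitePlace.mk τ' ≠ InfinitePlace.mk ι → (H.map τ').PosDef) → 2 ≤ Module.finrank ℚ ↥(maximalRealSubfield L) →
        ∀ {n' : ℕ} (e₁ : Fin 3 × Fin 1 ≃ Fin n') (dV : Fin 3 → L) (hdV : ∀ i, IsCMField.complexConj L (dV i) = dV i)
          (hdV0 : ∀ i, dV i ≠ 0) (g : GL (Fin 3) L)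
          (hg : ((g : Matrix (Fin 3) (Fin 3) L).map (cmConjRingHom L))ᵀ * H * (g : Matrix (Fin 3) (Fin 3) L) = Matrix.diagonal dV)
          (ιV : finAdelic (↥(maximalRealSubfield L)) L (IsCMField.complexConj L) 3 H →*
              finAdelic (↥(maximalRealSubfield L)) L (IsCMField.complexConj L) 3 (Matrix.diagonal dV)),
            (∀ k, ((ιV k : finAdelic (↥(maximalRealSubfield L)) L (IsCMField.complexConj L) 3 (Matrix.diagonal dV)) :
                GL (Fin 3) (FiniteAdeleRing (𝓞 L) L)) =
              (toFinAdeleGL L 3 g)⁻¹ * (k : GL (Fin 3) (FiniteAdeleRing (𝓞 L) L)) * toFinAdeleGL L 3 g) →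
            ∀ (μA : Measure (adelicGroupData (↥(maximalRealSubfield L)) L (IsCMField.complexConj L) 3 H).automorphicQuotient)
              [(adelicGroupData (↥(maximalRealSubfield L)) L (IsCMField.complexConj L) 3 H).IsAutomorphicMeasure μA],
              ∀ P : DiscreteAutomorphicRep (adelicGroupData (↥(maximalRealSubfield L)) L (IsCMField.complexConj L) 3 H) μA,
                (P.IsHolCotangentAt (cmArchSection L ι H T hT) (cmCompactFactor L ι H T hT) ∨
                  P.IsAntiholCotangentAt (cmArchSection L ι H T hT) (cmCompactFactor L ι H T hT)) →
                ∀ (μ : Literature.NumberTheory.Automorphic.IdeleClassGroup L →ₜ* Circle) (hμ : IsConjugateSymplectic L μ), HasWeight L μ 1 →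
                  ∀ (a : (↥(maximalRealSubfield L))ˣ) (χ : Chi (↥(maximalRealSubfield L)) L (IsCMField.complexConj L)),
                    P.HasFinComponent
                      (rhoAtLine (↥(maximalRealSubfield L)) L (IsCMField.complexConj L) 3 e₁ (Matrix.diagonal dV)
                        (complexConj_imagUnit L) (imagUnit_ne_zero L) (imagUnit_mul_self L) (realDiagonal_isSymm L dV hdV)
                        (isUnit_det_realDiagonal L dV hdV hdV0) (realDiagonal_map L dV hdV).symm
                        (fun a => isCompatible_chiSplittingLine L e₁ dV hdV hdV0 (toHeckeCharacter L μ)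
                          (isUnitary_toHeckeCharacter L μ) ((isOscillatorChar_toHeckeCharacter_iff μ).mpr hμ)
                          (TW (↥(maximalRealSubfield L)) a) (isSymm_TW (↥(maximalRealSubfield L)) a)
                          (isUnit_det_TW (↥(maximalRealSubfield L)) a) (JW (↥(maximalRealSubfield L)) L a)
                          (JW_eq (↥(maximalRealSubfield L)) L a)) ιV a χ) →
                      Even ({v : HeightOneSpectrum (𝓞 ↥(maximalRealSubfield L)) |
                              locF (↥(maximalRealSubfield L)) (imagUnitSq L) a v ≠ 1}.ncard +
                        {φ : L →+* ℂ | φ ∈ hμ.cmType.1 ∧ 0 < (φ (2 * imagUnit L)⁻¹).im}.ncard)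
    )
    (hJ3a : HJ3aType) (hocc : HoccType) :
    Summit.HodgeConjecture.HodgeConjecture.Theses.HCCMUnconditional.H413 :=
  H413_of_CE_U4
    (F0P2eCEOfRung2.stubCE_of_PK_GL_LW_LR_LTpu hPK F0P2eStubGLGlobalLine.stubGL_holds F0P2eStubLWLocalWitness.stubLW_holds
      F0P2eStubLRLocalReindex.stubLR_holds F0P2eStubLTLocalTypeTransport.stubLT_prodUnique_holds)
    (F0P2fE3OfRung2.stubU4_of_E3flat hE) hJ3a hocc

end Summit.HodgeConjecture.HodgeConjecture.Cruxes.H413.F0P2cSocketC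

end
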